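import Summits.QuantumFields.YangMills.Theorems.UnitScaleTiltProp7CornerCombInCellLetters
import Summits.QuantumFields.YangMills.Theorems.UnitScaleTiltProp7CornerCombFlatJensen
import Summits.QuantumFields.YangMills.Theorems.UnitScaleTiltProp7CombTrueStepDefectCell
import Mathlib.Algebra.Order.Chebyshev
import HarnessLib

/-!
# Route `UnitScaleTilt`, crux K1 «MinimiserStabilityRegPr» (stmt-QuantumFields-19200), route-R E′ (A′)-on-Σ, P-A2 (β), row «(n3)-comb» —
# (O2) GROUNDWORK, file F-6c-1: THE STRAIGHT-STEP MEAN IDENTITY AND THE ONE-SCALE FLAT ROW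
# («the block mean of one straight step is `L` times the average of the `L` shifted big-cube means one level down; hence two consecutive
# normalised block means at a common corner differ by a Poincaré term on a cube of side `L² + L`»)

«(O2) groundwork — not consumed by any displayed row before the freeze lifts» (★★OWNER `ym3-torus-plan` g29 RULINGS №20 (2), №22; «(II) GO» 06:26∕06:31Z;
PENS ROUND 3 08:01:48Z: F-6c in the level-by-level organisation «β»).  Cell `ym3-torus`, D-0154 (3c) R3 twin-width seat `ym-routeR-w1` (gen 9).
THEOREMS ONLY (0 `def`, 0 `sorry`); `--supports stmt-QuantumFields-19200 --as helper`, count-neutral.  YM₃ on T³ is a ladder rung (R3), not the Clay problem;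
nothing here claims `hMcomb`, `hMcomb₂`, (β), `hPA2`, `hcoS`, the stub, the crux, d = 4 or the mass gap.

THE POINT (MASTER `DESIGN-N3COMB-LINEAR-CORE-routeRw1g9.md` §1 row 7 «scale chain», organisation β).  In the structure theorem ✓`Prop7CornerCombStructure.
cornerComb_structure` the gauge sector is `Λ_k(z) = Σ_{m<k} CM_m(G_m)(L^{k−1−m}•z)`, each corner charge being (F-6a-2 ✓`norm_FhatCov_sub_drift_sq_le`) a weighted
sum of the BLOCK MEANS of the level-`m` field `G_m` over the level-`m` block cornered at the common physical corner, plus an in-cell oscillation.  The scale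
chain (✓`Prop7LatticeScaleTelescoping` §1, `norm_sub_sq_le_of_scale_steps`) telescopes the NORMALISED block means `L⁻ⁱ·mean_{B^i}(G_i)` in the level `i`;
its one-scale input compares `L^{−(i+1)}·mean_{B^{i+1}}(G_{i+1})` with `L⁻ⁱ·mean_{B^i}(G_i)`, and `G_{i+1}` is ONE straight step of `G_i` (plus defects).
This file is the FLAT, EXACT core of that input, in the letters of ✓II-1 `Prop7CornerCombFlatStructure` (`S (m+1) z κ = Σ_r L⁻ᵈ • asum (S m) (L•z + r) (seg κ L)`):
* §1 ★★ `blockSum_straightStep_eq` — THE STRAIGHT-STEP MEAN IDENTITY: for the level-(i+1) block `q′ + [0,L)ᵈ`,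
  `Σ_{z′} S′ (q′ + z′) μ = L⁻ᵈ • Σ_{t<L} Σ_{x ∈ [0,L²)ᵈ} S (L•q′ + x + t•e_μ) μ`
  (the `Lᵈ·Lᵈ` base points `L•(q′+z′) + r` tile the level-`i` cube `L•q′ + [0,L²)ᵈ` exactly once — ✓`Prop7CombTrueStepDefectCell.sum_cell_tiling` — and the straight
  run of length `L` is the `t`-shift; ✓`Prop7CornerCombFlatJensen.straight_step_eq_sum`).  Normalised: `mean_{B′}(S′_μ) = Σ_{t<L} mean_{C + t e_μ}(S_μ)`, `C = L•q′ + [0,L²)ᵈ`.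
* §2 ★★ `normSq_invL_mean_straightStep_sub_mean_le` — THE ONE-SCALE FLAT ROW (`M_N(ℂ)`-valued fields, operator norm): with `q = L•q′` and any cube
  `Q = q + [0,n+1)ᵈ` with `L² + L ≤ n + 1` (it contains the small block `q + [0,L)ᵈ` and the `L` shifted big cubes),
  `‖L⁻¹ • mean_{B′}(S′_μ) − mean_{q + [0,L)ᵈ}(S_μ)‖² ≤ 4·L⁻ᵈ·(N∕8)(n+1)²·Σ_ν Σ_{ρ ∈ Q, ρ_ν < n} ‖S (q + ρ + e_ν) μ − S (q + ρ) μ‖²`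
  — JENSEN against the mean over `Q` for each of the `L + 1` means (each index set injects into `Q`'s), then the cube Poincaré inequality with the mean
  ✓`Prop7CornerCombInCellLetters.sum_normSq_sub_mean_le` ([Balaban1983RegularityDecay] (2.27)); the `L⁻ᵈ = |B|⁻¹` is the d = 3 gain `side² ∕ |B| = L^{4−d}`·(const) that makes
  the scale chain converge (✓II-3's `(s₀Lⁱ)⁻¹`).  Constants: `4·L⁻ᵈ·(N∕8)(n+1)²` — closed in (d, L, n, N); nothing reads a level, `k`, the torus, `K`, the member ((g1)(g2)).
HONEST SCOPE.  Flat bookkeeping (exact identity + Jensen + cited Poincaré); the dressed twin (transported means, two-level re-basing, `DEF`) is F-6c-2, the chain per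
corner F-6c-3.  Nothing of Bałaban's is asserted beyond the cited tree∕lit theorems.

References: T. Bałaban, CMP **98** (1985) 17–51 [Balaban1985Averaging] ((42)–(43) pp.23–24, (125) p.36); CMP **89** (1983) 571–597 [Balaban1983RegularityDecay] ((2.27) p.580);
M. Giaquinta, Annals of Math. Studies 105 (1983) [Giaquinta1984] (Ch. III §1).
-/

set_option autoImplicit false

noncomputable section

open scoped BigOperators Matrix.Norms.L2Operator

namespace Summit.QuantumFields.YangMills.Theorems.Prop7CornerCombStraightStepMean

open Finset
open Literature.MathematicalPhysics.QuantumFieldTheory.Balaban1983to89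
open B7Prop1Explicit (Site e boxVec asum seg e_apply)
open Beta.CoordCubePoincare (stepUp)
open Summit.QuantumFields.YangMills.Theorems.Prop7CovariantCoercivity (intVec_stepUp)
open Summit.QuantumFields.YangMills.Theorems.Prop7CornerCombFlatJensen (straight_step_eq_sum)
open Summit.QuantumFields.YangMills.Theorems.Prop7CombTrueStepDefectCell (sum_cell_tiling)
open Summit.QuantumFields.YangMills.Theorems.Prop7CornerCombInCellLetters (sum_normSq_sub_mean_le)

/-! ## §1 The straight-step mean identity (any normed ring with an `ℝ`-module structure; exact) -/

section Identity

variable {d : ℕ} {𝔸 : Type*} [NormedRing 𝔸] [NormedSpace ℝ 𝔸]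

/-- ★★ **THE STRAIGHT-STEP MEAN IDENTITY**: if `S′ z μ = Σ_{r ∈ [0,L)ᵈ} L⁻ᵈ • S([L•z + r, L•z + r + L e_μ])` (one straight step, ✓II-1's `hS`), then the block SUM of
`S′(·) μ` over the level-(i+1) block `q′ + [0,L)ᵈ` is `L⁻ᵈ • Σ_{t<L} Σ_{x ∈ [0,L²)ᵈ} S (L•q′ + x + t•e_μ) μ` — i.e. `mean_{B′}(S′_μ) = Σ_{t<L} mean_{L•q′ + [0,L²)ᵈ + t e_μ}(S_μ)`.
[cite: Balaban1985Averaging, (125) p.36, (42) p.23] -/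
theorem blockSum_straightStep_eq (L : ℕ) (hL : 1 ≤ L) (Sm Sm1 : Site d → Fin d → 𝔸) (μ : Fin d) (q' : Site d)
    (h : ∀ z : Site d, Sm1 z μ = ∑ r : Fin d → Fin L, (((L : ℝ) ^ d)⁻¹) • asum Sm ((L : ℤ) • z + boxVec L r) (seg μ (L : ℤ))) :
    ∑ z' : Fin d → Fin L, Sm1 (q' + boxVec L z') μ
      = (((L : ℝ) ^ d)⁻¹) • ∑ t ∈ Finset.range L, ∑ x : Fin d → Fin (L * L), Sm ((L : ℤ) • q' + boxVec (L * L) x + (t : ℤ) • e μ) μ := by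
  have hstep : ∀ z' : Fin d → Fin L, Sm1 (q' + boxVec L z') μ
      = ∑ r : Fin d → Fin L, ∑ t ∈ Finset.range L, (((L : ℝ) ^ d)⁻¹) • Sm ((L : ℤ) • (q' + boxVec L z') + boxVec L r + (t : ℤ) • e μ) μ :=
    fun z' => straight_step_eq_sum L Sm Sm1 (q' + boxVec L z') μ (h _)
  simp only [hstep]
  -- move the `t`-sum outside and the scalar out
  have hswap : ∑ z' : Fin d → Fin L, ∑ r : Fin d → Fin L, ∑ t ∈ Finset.range L,
        (((L : ℝ) ^ d)⁻¹) • Sm ((L : ℤ) • (q' + boxVec L z') + boxVec L r + (t : ℤ) • e μ) μ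
      = ∑ t ∈ Finset.range L, ∑ z' : Fin d → Fin L, ∑ r : Fin d → Fin L,
        (((L : ℝ) ^ d)⁻¹) • Sm ((L : ℤ) • (q' + boxVec L z') + boxVec L r + (t : ℤ) • e μ) μ := by
    calc _ = ∑ z' : Fin d → Fin L, ∑ t ∈ Finset.range L, ∑ r : Fin d → Fin L,
          (((L : ℝ) ^ d)⁻¹) • Sm ((L : ℤ) • (q' + boxVec L z') + boxVec L r + (t : ℤ) • e μ) μ :=
          Finset.sum_congr rfl fun z' _ => Finset.sum_comm
      _ = _ := Finset.sum_comm
  rw [hswap, Finset.smul_sum]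
  refine Finset.sum_congr rfl fun t _ => ?_
  -- the `Lᵈ·Lᵈ` base points tile the cube of side `L²`
  have htile := sum_cell_tiling (d := d) (M := 𝔸) L L hL (fun v : Site d => Sm ((L : ℤ) • q' + v + (t : ℤ) • e μ) μ)
  rw [htile, Finset.smul_sum]
  refine Finset.sum_congr rfl fun z' _ => ?_
  rw [Finset.smul_sum]
  refine Finset.sum_congr rfl fun r _ => ?_
  congr 2
  rw [smul_add]; abel

/-- The normalised form of §1: `L⁻ᵈ • Σ_{z′} S′ (q′ + z′) μ = Σ_{t<L} ((L²)ᵈ)⁻¹ • Σ_{x ∈ [0,L²)ᵈ} S (L•q′ + x + t•e_μ) μ` (`mean_{B′}(S′_μ) = Σ_t mean_{C_t}(S_μ)`).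
[cite: Balaban1985Averaging, (125) p.36, (42) p.23] -/
theorem mean_straightStep_eq (L : ℕ) (hL : 1 ≤ L) (Sm Sm1 : Site d → Fin d → 𝔸) (μ : Fin d) (q' : Site d)
    (h : ∀ z : Site d, Sm1 z μ = ∑ r : Fin d → Fin L, (((L : ℝ) ^ d)⁻¹) • asum Sm ((L : ℤ) • z + boxVec L r) (seg μ (L : ℤ))) :
    (((L : ℝ) ^ d)⁻¹) • ∑ z' : Fin d → Fin L, Sm1 (q' + boxVec L z') μ
      = ∑ t ∈ Finset.range L, ((((L * L : ℕ) : ℝ) ^ d)⁻¹) • ∑ x : Fin d → Fin (L * L), Sm ((L : ℤ) • q' + boxVec (L * L) x + (t : ℤ) • e μ) μ := by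
  rw [blockSum_straightStep_eq L hL Sm Sm1 μ q' h, smul_smul, Finset.smul_sum]
  refine Finset.sum_congr rfl fun t _ => ?_
  congr 1
  push_cast
  rw [mul_pow, mul_inv]

end Identity

/-! ## §2 The one-scale flat row (`M_N(ℂ)`-valued fields, operator norm) -/

section Row

variable {d N : ℕ}

/-- The small block's index set injects into the big cube's: `s ↦ s` read in `Fin (n+1)` (`L ≤ n+1`). [folklore] -/
theorem boxVec_castLE {L n : ℕ} (hLn : L ≤ n + 1) (s : Fin d → Fin L) :
    boxVec (n + 1) (fun i => Fin.castLE hLn (s i)) = boxVec L s := by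
  funext i; simp [boxVec]

/-- The shifted big cube's index set injects into the big cube's: `x ↦ x + t δ_μ` read in `Fin (n+1)` (`L² + L ≤ n+1`, `t < L`). [folklore] -/
theorem boxVec_shiftEmb {L n : ℕ} (hn : L * L + L ≤ n + 1) (μ : Fin d) {t : ℕ} (ht : t < L) (x : Fin d → Fin (L * L)) :
    boxVec (n + 1) (fun i => (⟨(x i : ℕ) + (if i = μ then t else 0), by
        have hx := (x i).isLt; split_ifs <;> omega⟩ : Fin (n + 1)))
      = boxVec (L * L) x + (t : ℤ) • e μ := by
  funext i
  simp only [boxVec, Pi.add_apply, Pi.smul_apply, e_apply, smul_eq_mul]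
  split_ifs with hi <;> push_cast <;> ring

/-- JENSEN AGAINST A CONSTANT over an injected index set: for an injection `ι : α ↪ β` (finite types) and any `c`,
`‖|α|⁻¹ • Σ_a F (ι a) − c‖² ≤ |α|⁻¹ · Σ_b ‖F b − c‖²`. [folklore] [cite: Giaquinta1984, Ch. III §1 p.70] -/
theorem normSq_mean_comp_sub_le {α β : Type*} [Fintype α] [Fintype β] [Nonempty α] (ι : α → β) (hι : Function.Injective ι)
    (F : β → Matrix (Fin N) (Fin N) ℂ) (c : Matrix (Fin N) (Fin N) ℂ) :
    ‖((Fintype.card α : ℝ))⁻¹ • ∑ a, F (ι a) - c‖ ^ 2 ≤ ((Fintype.card α : ℝ))⁻¹ * ∑ b, ‖F b - c‖ ^ 2 := by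
  classical
  have hn : (0 : ℝ) < Fintype.card α := by exact_mod_cast Fintype.card_pos
  have hsub : ((Fintype.card α : ℝ))⁻¹ • ∑ a, F (ι a) - c = ((Fintype.card α : ℝ))⁻¹ • ∑ a, (F (ι a) - c) := by
    rw [Finset.sum_sub_distrib, Finset.sum_const, Finset.card_univ, ← Nat.cast_smul_eq_nsmul ℝ, smul_sub, smul_smul,
      inv_mul_cancel₀ hn.ne', one_smul]
  rw [hsub, norm_smul, Real.norm_eq_abs, abs_of_pos (inv_pos.2 hn), mul_pow]
  have h1 : ‖∑ a, (F (ι a) - c)‖ ≤ ∑ a, ‖F (ι a) - c‖ := norm_sum_le _ _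
  have h2 : (∑ a, ‖F (ι a) - c‖) ^ 2 ≤ (Finset.univ : Finset α).card * ∑ a, ‖F (ι a) - c‖ ^ 2 := sq_sum_le_card_mul_sum_sq
  rw [Finset.card_univ] at h2
  -- the injected sum is at most the full sum
  have h3 : ∑ a, ‖F (ι a) - c‖ ^ 2 ≤ ∑ b, ‖F b - c‖ ^ 2 := by
    rw [← Finset.sum_image (f := fun b => ‖F b - c‖ ^ 2) (s := Finset.univ) (g := ι) (fun a _ b _ hab => hι hab)]
    exact Finset.sum_le_sum_of_subset_of_nonneg (Finset.subset_univ _) fun b _ _ => sq_nonneg _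
  have h12 : ‖∑ a, (F (ι a) - c)‖ ^ 2 ≤ Fintype.card α * ∑ b, ‖F b - c‖ ^ 2 :=
    ((pow_le_pow_left₀ (norm_nonneg _) h1 2).trans h2).trans (mul_le_mul_of_nonneg_left h3 hn.le)
  calc ((Fintype.card α : ℝ)⁻¹) ^ 2 * ‖∑ a, (F (ι a) - c)‖ ^ 2 ≤ ((Fintype.card α : ℝ)⁻¹) ^ 2 * (Fintype.card α * ∑ b, ‖F b - c‖ ^ 2) :=
        mul_le_mul_of_nonneg_left h12 (sq_nonneg _)
    _ = ((Fintype.card α : ℝ))⁻¹ * ∑ b, ‖F b - c‖ ^ 2 := by field_simp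

/-- ★★ **THE ONE-SCALE FLAT ROW**: for one straight step `S ↦ S′` (✓II-1's `hS`), a level-(i+1) corner `q′`, `q = L•q′`, a direction `μ`, and any cube `q + [0,n+1)ᵈ`
with `L² + L ≤ n + 1`:
`‖L⁻¹ • mean_{q′+[0,L)ᵈ}(S′_μ) − mean_{q+[0,L)ᵈ}(S_μ)‖² ≤ 4·L⁻ᵈ·((N∕8)(n+1)²·Σ_ν Σ_{ρ : ρ_ν ≠ n} ‖S (q + ρ + e_ν) μ − S (q + ρ) μ‖²)`
(§1 + Jensen against the mean over the cube for each of the `L + 1` means + the cube Poincaré inequality with the mean ✓`sum_normSq_sub_mean_le`).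
[cite: Balaban1983RegularityDecay, (2.27) p.580; Balaban1985Averaging, (125) p.36] -/
theorem normSq_invL_mean_straightStep_sub_mean_le (L : ℕ) (hL : 1 ≤ L) (n : ℕ) (hn : L * L + L ≤ n + 1)
    (Sm Sm1 : Site d → Fin d → Matrix (Fin N) (Fin N) ℂ) (μ : Fin d) (q' : Site d)
    (h : ∀ z : Site d, Sm1 z μ = ∑ r : Fin d → Fin L, (((L : ℝ) ^ d)⁻¹) • asum Sm ((L : ℤ) • z + boxVec L r) (seg μ (L : ℤ))) :
    ‖(L : ℝ)⁻¹ • ((((L : ℝ) ^ d)⁻¹) • ∑ z' : Fin d → Fin L, Sm1 (q' + boxVec L z') μ)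
        - (((L : ℝ) ^ d)⁻¹) • ∑ s : Fin d → Fin L, Sm ((L : ℤ) • q' + boxVec L s) μ‖ ^ 2
      ≤ 4 * ((L : ℝ) ^ d)⁻¹ * (N / 8 * ((n : ℝ) + 1) ^ 2 *
          ∑ ν : Fin d, ∑ ρ ∈ univ.filter (fun ρ : Fin d → Fin (n + 1) => ρ ν ≠ Fin.last n),
            ‖Sm ((L : ℤ) • q' + boxVec (n + 1) ρ + e ν) μ - Sm ((L : ℤ) • q' + boxVec (n + 1) ρ) μ‖ ^ 2) := by
  classical
  have hL0 : 0 < L := hL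
  have hLr : (0 : ℝ) < L := by exact_mod_cast hL0
  have hLn : L ≤ n + 1 := le_trans (Nat.le_add_left L (L * L)) (by simpa [add_comm] using hn)
  haveI : Nonempty (Fin d → Fin L) := ⟨fun _ => ⟨0, hL0⟩⟩
  haveI : Nonempty (Fin d → Fin (L * L)) := ⟨fun _ => ⟨0, Nat.mul_pos hL0 hL0⟩⟩
  -- letters
  set q : Site d := (L : ℤ) • q' with hq
  set F : (Fin d → Fin (n + 1)) → Matrix (Fin N) (Fin N) ℂ := fun ρ => Sm (q + boxVec (n + 1) ρ) μ with hF
  set Fbar : Matrix (Fin N) (Fin N) ℂ := (((n : ℝ) + 1) ^ d)⁻¹ • ∑ ρ, F ρ with hFbar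
  set P : ℝ := ∑ ρ, ‖F ρ - Fbar‖ ^ 2 with hP
  set GRAD : ℝ := ∑ ν : Fin d, ∑ ρ ∈ univ.filter (fun ρ : Fin d → Fin (n + 1) => ρ ν ≠ Fin.last n),
      ‖Sm (q + boxVec (n + 1) ρ + e ν) μ - Sm (q + boxVec (n + 1) ρ) μ‖ ^ 2 with hGRAD
  have hP0 : 0 ≤ P := Finset.sum_nonneg fun _ _ => sq_nonneg _
  -- Poincaré with the mean on the cube
  have hPle : P ≤ N / 8 * ((n : ℝ) + 1) ^ 2 * GRAD := by
    have hpc := sum_normSq_sub_mean_le n F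
    have hgrad : ∑ ν : Fin d, ∑ ρ ∈ univ.filter (fun ρ : Fin d → Fin (n + 1) => ρ ν ≠ Fin.last n), ‖F (stepUp ρ ν) - F ρ‖ ^ 2 = GRAD := by
      rw [hGRAD]
      refine Finset.sum_congr rfl fun ν _ => Finset.sum_congr rfl fun ρ hρ => ?_
      have hρ' : ρ ν ≠ Fin.last n := (Finset.mem_filter.mp hρ).2
      have hst : boxVec (n + 1) (stepUp ρ ν) = boxVec (n + 1) ρ + e ν := intVec_stepUp ρ ν hρ'
      simp only [hF, hst, add_assoc]
    rw [hP, hFbar, ← hgrad]; exact hpc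
  -- the small block mean: Jensen against `Fbar`
  have hιB : Function.Injective (fun s : Fin d → Fin L => fun i => Fin.castLE hLn (s i)) := by
    intro s s' hss'; funext i
    have := congrFun hss' i; exact Fin.castLE_injective hLn this
  have hcardB : (Fintype.card (Fin d → Fin L) : ℝ) = (L : ℝ) ^ d := by
    rw [Fintype.card_fun, Fintype.card_fin, Fintype.card_fin]; push_cast; ring
  have hB : ‖(((L : ℝ) ^ d)⁻¹) • ∑ s : Fin d → Fin L, Sm (q + boxVec L s) μ - Fbar‖ ^ 2 ≤ ((L : ℝ) ^ d)⁻¹ * P := by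
    have hJ := normSq_mean_comp_sub_le (fun s : Fin d → Fin L => fun i => Fin.castLE hLn (s i)) hιB F Fbar
    rw [hcardB] at hJ
    have hre : ∑ s : Fin d → Fin L, F (fun i => Fin.castLE hLn (s i)) = ∑ s : Fin d → Fin L, Sm (q + boxVec L s) μ := by
      refine Finset.sum_congr rfl fun s _ => ?_
      simp only [hF, boxVec_castLE hLn s]
    rw [hre] at hJ
    exact hJ
  -- the shifted big cube means: Jensen against `Fbar`
  have hcardC : (Fintype.card (Fin d → Fin (L * L)) : ℝ) = (((L * L : ℕ) : ℝ)) ^ d := by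
    rw [Fintype.card_fun, Fintype.card_fin, Fintype.card_fin]; push_cast; ring
  have hC : ∀ t ∈ Finset.range L,
      ‖((((L * L : ℕ) : ℝ) ^ d)⁻¹) • ∑ x : Fin d → Fin (L * L), Sm (q + boxVec (L * L) x + (t : ℤ) • e μ) μ - Fbar‖ ^ 2 ≤ ((L : ℝ) ^ d)⁻¹ * P := by
    intro t ht
    have ht' : t < L := Finset.mem_range.mp ht
    let ιC : (Fin d → Fin (L * L)) → (Fin d → Fin (n + 1)) := fun x i =>
      (⟨(x i : ℕ) + (if i = μ then t else 0), by have hx := (x i).isLt; split_ifs <;> omega⟩ : Fin (n + 1))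
    have hιC : Function.Injective ιC := by
      intro x x' hxx'; funext i
      have hi : ((ιC x i : Fin (n + 1)) : ℕ) = ((ιC x' i : Fin (n + 1)) : ℕ) := by rw [hxx']
      change (x i : ℕ) + (if i = μ then t else 0) = (x' i : ℕ) + (if i = μ then t else 0) at hi
      exact Fin.ext (by omega)
    have hJ := normSq_mean_comp_sub_le ιC hιC F Fbar
    rw [hcardC] at hJ
    have hre : ∑ x : Fin d → Fin (L * L), F (ιC x) = ∑ x : Fin d → Fin (L * L), Sm (q + boxVec (L * L) x + (t : ℤ) • e μ) μ := by
      refine Finset.sum_congr rfl fun x _ => ?_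
      simp only [hF, ιC, boxVec_shiftEmb hn μ ht' x, add_assoc]
    rw [hre] at hJ
    refine hJ.trans ?_
    -- `((L²)ᵈ)⁻¹ ≤ (Lᵈ)⁻¹`
    refine mul_le_mul_of_nonneg_right ?_ hP0
    refine inv_anti₀ (by positivity) ?_
    push_cast
    rw [mul_pow]
    exact le_mul_of_one_le_left (by positivity) (one_le_pow₀ (by exact_mod_cast hL))
  -- assemble: the difference is `L⁻¹ • Σ_t (mean_{C_t} − Fbar) − (mean_B − Fbar)`
  have hmean := mean_straightStep_eq L hL Sm Sm1 μ q' h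
  set mB := (((L : ℝ) ^ d)⁻¹) • ∑ s : Fin d → Fin L, Sm (q + boxVec L s) μ with hmB
  set mC : ℕ → Matrix (Fin N) (Fin N) ℂ := fun t =>
    ((((L * L : ℕ) : ℝ) ^ d)⁻¹) • ∑ x : Fin d → Fin (L * L), Sm (q + boxVec (L * L) x + (t : ℤ) • e μ) μ with hmC
  have hdiff : (L : ℝ)⁻¹ • ((((L : ℝ) ^ d)⁻¹) • ∑ z' : Fin d → Fin L, Sm1 (q' + boxVec L z') μ) - mB
      = (L : ℝ)⁻¹ • ∑ t ∈ Finset.range L, (mC t - Fbar) - (mB - Fbar) := by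
    rw [hmean]
    have hconst : (L : ℝ)⁻¹ • ∑ t ∈ Finset.range L, (mC t - Fbar) = (L : ℝ)⁻¹ • ∑ t ∈ Finset.range L, mC t - Fbar := by
      rw [Finset.sum_sub_distrib, Finset.sum_const, Finset.card_range, ← Nat.cast_smul_eq_nsmul ℝ, smul_sub, smul_smul,
        inv_mul_cancel₀ hLr.ne', one_smul]
    rw [hconst]
    simp only [hmC, hq]
    abel
  -- norms
  set R : ℝ := Real.sqrt (((L : ℝ) ^ d)⁻¹ * P) with hR
  have hR0 : 0 ≤ R := Real.sqrt_nonneg _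
  have hRsq : R ^ 2 = ((L : ℝ) ^ d)⁻¹ * P := Real.sq_sqrt (by positivity)
  have hsq : ∀ (v : Matrix (Fin N) (Fin N) ℂ), ‖v‖ ^ 2 ≤ ((L : ℝ) ^ d)⁻¹ * P → ‖v‖ ≤ R := fun v hv => by
    rw [hR, ← Real.sqrt_sq (norm_nonneg v)]
    exact Real.sqrt_le_sqrt hv
  have hBn : ‖mB - Fbar‖ ≤ R := hsq _ hB
  have hCn : ∀ t ∈ Finset.range L, ‖mC t - Fbar‖ ≤ R := fun t ht => hsq _ (hC t ht)
  have hsumn : ‖(L : ℝ)⁻¹ • ∑ t ∈ Finset.range L, (mC t - Fbar)‖ ≤ R := by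
    rw [norm_smul, Real.norm_eq_abs, abs_of_pos (inv_pos.2 hLr)]
    calc (L : ℝ)⁻¹ * ‖∑ t ∈ Finset.range L, (mC t - Fbar)‖ ≤ (L : ℝ)⁻¹ * ∑ t ∈ Finset.range L, ‖mC t - Fbar‖ :=
          mul_le_mul_of_nonneg_left (norm_sum_le _ _) (inv_pos.2 hLr).le
      _ ≤ (L : ℝ)⁻¹ * ∑ t ∈ Finset.range L, R := mul_le_mul_of_nonneg_left (Finset.sum_le_sum hCn) (inv_pos.2 hLr).le
      _ = R := by rw [Finset.sum_const, Finset.card_range, nsmul_eq_mul]; field_simp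
  have hnorm : ‖(L : ℝ)⁻¹ • ((((L : ℝ) ^ d)⁻¹) • ∑ z' : Fin d → Fin L, Sm1 (q' + boxVec L z') μ) - mB‖ ≤ 2 * R := by
    rw [hdiff]
    calc _ ≤ ‖(L : ℝ)⁻¹ • ∑ t ∈ Finset.range L, (mC t - Fbar)‖ + ‖mB - Fbar‖ := norm_sub_le _ _
      _ ≤ R + R := add_le_add hsumn hBn
      _ = 2 * R := by ring
  have hGRAD0 : 0 ≤ GRAD := by
    rw [hGRAD]; exact Finset.sum_nonneg fun _ _ => Finset.sum_nonneg fun _ _ => sq_nonneg _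
  calc _ ≤ (2 * R) ^ 2 := pow_le_pow_left₀ (norm_nonneg _) hnorm 2
    _ = 4 * (((L : ℝ) ^ d)⁻¹ * P) := by rw [mul_pow, hRsq]; norm_num
    _ ≤ 4 * (((L : ℝ) ^ d)⁻¹ * (N / 8 * ((n : ℝ) + 1) ^ 2 * GRAD)) :=
        mul_le_mul_of_nonneg_left (mul_le_mul_of_nonneg_left hPle (by positivity)) (by norm_num)
    _ = _ := by ring

end Row

end Summit.QuantumFields.YangMills.Theorems.Prop7CornerCombStraightStepMean
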